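import Literature.NumberTheory.EllipticCurves.Rank1Residual.Typed.SelmerCardCertificate
import Literature.NumberTheory.EllipticCurves.Rank1Residual.Typed.X12
import HarnessLib

/-!
# X12 (CM, analytic rank one) — the booking SHAPE of a `p`-Selmer-cardinality certificate
# (`#Sel^(p)(E/ℚ) ∣ p`, e.g. the Eisenstein/Kummer `φ`-descent at a CM-RAMIFIED prime): `BSD(E,p)`
# at a pair with `ord_p #Ш_an = 0`

HONEST FRAMING (cell `b2b-bsdres`, run/shared/lean/b2b/bsd-rank1-residual/, verbatim in every
file): the goal of the cell is to DELETE the COMBINATION-SHAPED residual classes of the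
Birch–Swinnerton-Dyer formula for ALL analytic-rank `≤ 1` elliptic curves over `ℚ` — "full BSD
formula for every rank `≤ 1` curve in class `C`" assembled STRICTLY from published theorems — so
that the rank-`≤ 1` remainder becomes exactly the CONSTRUCTION-SHAPED classes, which are TYPED
(missing-input `Prop`s), NOT attempted. This is not "finishing BSD". Unit `b2b-bsdres-x1b`
(CLASS-OWNERS row "X12 inert-bad core", prover owner), generation 10; research route, no claim
beyond the stated class; PER PAIR, not a class theorem; NOTHING booked (the lane books, under the
referee's conditions); X12 REMAINS CONSTRUCTION-SHAPED.

Theorems only (compositions of tree theorems BY NAME); no definition, no named fact.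

## What this file records

At the 15 CM-RAMIFIED X12 pairs of the census window (`p ≥ 5`, `p ∣ d_K`; `E[p]` REDUCIBLE, so
neither Kolyvagin–Matar–Nekovář nor the class-level upper half of `X12/InertCoreUpperHalf.lean`
applies, and Lawson–Wuthrich Thm. 14 is disputed in print) the per-pair lever is a `p`-DESCENT:
sha-2's two `p`-isogeny-descent engines CLOSED 12 of them; 3 (`1849a1@43`, `4489a1@67`, `9025a1@19`)
resisted on the S-unit/class-group step of the degree-`21/42`, `33/66`, `36` kernel fields. The X12
owner's memo `HOME/b2b-bsdres-x1b/gen10/ramified3/EISENSTEIN-DESCENT.md` gives an Eisenstein/Kummer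
`φ`-descent for `E = A(p) ⊗ ε_D` (Gross's curve twisted) whose class-group step is a THEOREM
(Kummer's regularity criterion; Herbrand + Leopoldt reflection; Stickelberger/Gras for
`ℚ(μ_p, √D)`) and whose output is `dim_𝔽_p Sel^{(p)}(E/ℚ) ≤ 1`, i.e. `#Sel^{(p)}(E/ℚ) ∣ p` — with
its finite inputs (isogeny character, Bernoulli data) re-computed by two code-independent engines
(kit j097002 / j097127, 65/65 rows agree; 63 of the 65 CM-ramified rank-one class-pairs with
`N < 5·10⁵` pass). THAT ARGUMENT IS NOT IN THE KERNEL and is ONE route pending the referee's ruling;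
this file only records the SHAPE in which such a certificate closes a pair:

* `card_selmerGroup_eq_of_dvd_of_rank_eq_one` — `#Sel^{(p)}(E/ℚ) ∣ p` and `rank_ℤ E(ℚ) = 1` force
  `#Sel^{(p)}(E/ℚ) = p` (Mordell–Weil: `p ∣ #(E(ℚ)/pE(ℚ))`, and `E(ℚ)/pE(ℚ) ↪ Sel^{(p)}` by the
  tree's PROVED fundamental exact sequence `selmer_exact_holds`);
* `bsdp_of_classX12_of_card_selmerGroup_dvd` — at an X12 pair (`r_an = 1` by the class) with
  `#Ш(E)_an = q`, `ord_p q = 0` and the certificate `#Sel^{(p)}(E/ℚ) ∣ p`: Miller's `BSD(E,p)`, via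
  the cell's class-free `Typed.bsdp_of_card_selmerGroup_eq_pow_analyticRank` (GZK `hGZK`);
* `missingInputAt_of_classX12_of_card_selmerGroup_dvd` — the typed residue `X12.MissingInputAt W p`
  at such a pair.

Inputs: PUBLISHED facts by name (GZK) + a per-pair COMPUTED certificate (`hdvd`) + the lane's exact
`#Ш_an`. Nothing asserted about any particular curve. [Miller2011LMS] Def. 1.1; [SilvermanAEC2009]
Thm. X.4.2 (a).
-/

noncomputable section

open scoped Classical

open WeierstrassCurve Literature.NumberTheory.EllipticCurves
  Literature.NumberTheory.EllipticCurves.Rank1Residual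
  Literature.NumberTheory.EllipticCurves.Rank1Residual.Typed

namespace Summit.BirchSwinnertonDyer.Rank1Residual.X12

section General

variable {K : Type*} [Field K] [NumberField K] (W : WeierstrassCurve K) [W.IsElliptic]

/-- **`#Sel^{(p)}(E/K) ∣ p` and `rank_ℤ E(K) = 1` ⇒ `#Sel^{(p)}(E/K) = p`** (any number field `K`).
Mordell–Weil (`module_finite_point_holds`) gives `p ^ rank ∣ #(E(K)/pE(K))`
(`pow_finrank_dvd_natCard_quotient_range_zsmul`); the PROVED fundamental exact sequence
(`selmer_exact_holds`, Silverman X.4.2 (a)) embeds `E(K)/pE(K)` as the image of the Kummer map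
inside `Sel^{(p)}`, which is finite because its order divides `p`; so `p ∣ #Sel^{(p)} ∣ p`. This is
the passage from a descent's output "`dim_𝔽_p Sel^{(p)} ≤ 1`" to the certificate line of
`Typed/SelmerCardCertificate.lean`. [cite: SilvermanAEC2009, Thm X.4.2(a)] -/
theorem card_selmerGroup_eq_of_dvd_of_rank_eq_one (p : ℕ) [hp : Fact p.Prime]
    (hdvd : Nat.card (W.selmerGroup (p : ℤ)) ∣ p) (hrank : W.mordellWeilRank = 1) :
    Nat.card (W.selmerGroup (p : ℤ)) = p := by
  have hp0 : (p : ℤ) ≠ 0 := by exact_mod_cast hp.out.ne_zero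
  haveI : NeZero p := ⟨hp.out.ne_zero⟩
  obtain ⟨κ, hker, hrange, -⟩ := selmer_exact_holds W (p : ℤ) hp0
  haveI : Module.Finite ℤ W.toAffine.Point := W.module_finite_point_holds
  -- `p = p ^ rank ∣ #(E(K)/pE(K)) = #(im κ)`
  have hdvd1 : p ∣ Nat.card κ.range := by
    have h := pow_finrank_dvd_natCard_quotient_range_zsmul (A := W.toAffine.Point) p
    have hequiv : Nat.card (W.toAffine.Point ⧸
        (zsmulAddGroupHom (α := W.toAffine.Point) (p : ℤ)).range) = Nat.card κ.range := by
      rw [← hker]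
      exact Nat.card_congr (QuotientAddGroup.quotientKerEquivRange κ).toEquiv
    rw [hequiv] at h
    have h1 : p ^ W.mordellWeilRank ∣ Nat.card κ.range := h
    rwa [hrank, pow_one] at h1
  have hle : κ.range ≤ W.selmerGroup (p : ℤ) := by rw [hrange]; exact inf_le_left
  haveI : Finite (W.selmerGroup (p : ℤ)) :=
    Nat.finite_of_card_ne_zero (fun h0 ↦ hp.out.ne_zero (Nat.eq_zero_of_zero_dvd (h0 ▸ hdvd)))
  have hdvd2 : Nat.card κ.range ∣ Nat.card (W.selmerGroup (p : ℤ)) := AddSubgroup.card_dvd_of_le hle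
  exact Nat.dvd_antisymm hdvd (hdvd1.trans hdvd2)

end General

/-- **X12 pair + `ord_p #Ш_an = 0` + the certificate `#Sel^{(p)}(E/ℚ) ∣ p` ⇒ `BSD(E,p)`.** At an X12
pair the class gives `ord_{s=1} L(E,s) = 1`, GZK (`hGZK`, bsd.S17) gives `rank_ℤ E(ℚ) = 1` and `Ш`
finite; `card_selmerGroup_eq_of_dvd_of_rank_eq_one` turns the certificate into `#Sel^{(p)} = p = p^{r_an}`,
and the cell's class-free `Typed.bsdp_of_card_selmerGroup_eq_pow_analyticRank` concludes
(`Ш(E/ℚ)[p] = 0`, Miller's last clause with `#Ш_an = q`, `ord_p q = 0`). The certificate `hdvd` is a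
COMPUTED per-pair input (for the CM-ramified pairs: the Eisenstein/Kummer `φ`-descent of the X12
owner's memo — NOT a kernel theorem, one route pending the referee); `hq`/`hv` is the lane's exact
`#Ш_an`. PER PAIR; nothing booked. [cite: Miller2011LMS, §1 and Def. 1.1]
[cite: SilvermanAEC2009, Thm X.4.2(a)] -/
theorem bsdp_of_classX12_of_card_selmerGroup_dvd
    (hGZK : rank_eq_analyticRank_of_analyticRank_le_one)
    (W : WeierstrassCurve ℚ) [W.IsElliptic] (p : ℕ) [Fact p.Prime] (hX : ClassX12 W p)
    {q : ℚ} (hq : shaAn W = (q : ℂ)) (hv : padicValRat p q = 0)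
    (hdvd : Nat.card (W.selmerGroup (p : ℤ)) ∣ p) : BSDp W p := by
  have hr : W.analyticRank = 1 := hX.2.1
  have hrank : W.mordellWeilRank = 1 := by rw [(hGZK W (by rw [hr])).1, hr]
  exact bsdp_of_card_selmerGroup_eq_pow_analyticRank W p hGZK (by rw [hr])
    hq hv (by rw [hr, pow_one]; exact card_selmerGroup_eq_of_dvd_of_rank_eq_one W p hdvd hrank)

/-- **… and the cell's typed residue `X12.MissingInputAt W p` holds at such a pair** (`BSD(E,p)` ⇒
`MissingPPartAt`, `Ш` finite by GZK). PER PAIR; nothing booked; X12 stays CONSTRUCTION-SHAPED.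
[cite: Miller2011LMS, §1 and Def. 1.1] -/
theorem missingInputAt_of_classX12_of_card_selmerGroup_dvd
    (hGZK : rank_eq_analyticRank_of_analyticRank_le_one)
    (W : WeierstrassCurve ℚ) [W.IsElliptic] (p : ℕ) [Fact p.Prime] (hX : ClassX12 W p)
    {q : ℚ} (hq : shaAn W = (q : ℂ)) (hv : padicValRat p q = 0)
    (hdvd : Nat.card (W.selmerGroup (p : ℤ)) ∣ p) : X12.MissingInputAt W p := fun _ ↦ by
  haveI : Finite W.sha := (hGZK W (by rw [hX.2.1])).2
  exact missingPPartAt_of_bsdp W p (bsdp_of_classX12_of_card_selmerGroup_dvd hGZK W p hX hq hv hdvd)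

end Summit.BirchSwinnertonDyer.Rank1Residual.X12

end
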